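import Summits.QuantumFields.BalabanUV.T4Continuum.Support.OutputRateFunctionalTables

/-!
# OutputRateFunctionalTablesFamily — the BACKGROUND-FAMILY currency of the re-indexed road: a step model over
# `paramCarriers C 𝒰` assembled from Bałaban's ONE pointwise functional and sup-normed background families, every kernel binder
# discharged from its POINTWISE-IN-THE-BACKGROUND form (NE5 crux O1, owner design item R48-F, second road; cell `pub-balaban`,
# T⁴ fan-out; `HOME/CLAIMS.log` l.15388 (R48), INTENT l.15569; part 2 of `OutputRateFunctionalTables`)

Unit `b2b-balaban-t4-ne5-formalise-leaf-02` (NE5 formalisation swarm, leaf prover 02, gen 16).  Summits-side NEW WORK under the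
LEAN PLACEMENT RULE (cell modelling + bookkeeping over ABSTRACT carriers; NOT a Literature module; nothing printed is asserted,
no `[cite:]` tag, no `Prop`-valued fact is minted — trigger c3).  HONEST FRAMING: rung (B)+1 of the FINITE-VOLUME T⁴ continuum
programme — NOT infinite volume, NOT a mass gap, NOT the Clay problem, NOT a proof of NE5 (NOT PRINTED; cell GAPS G-t4-U3-1).
HONEST DEPENDENCY (cell line, verbatim): continuum YM on T⁴ ⇐ BetaPertH ∧ nine spine estimates (0/9 proved); BetaPertH ⇐ (D1) ∧
(D4) ∧ CAP+tail; G-an2-4 gates asym, D1 and NE2/3/4.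

WHY.  Part 1 (`OutputRateFunctionalTables`; Road D, OF RECORD for R48-F by owner RULING R49, `CLAIMS.log` l.16073) moved the
background into the domain index (`paramCarriers C 𝒰`), so that a step model reads FUNCTION tables and the kernel's geometry-free
faces apply verbatim; the price, said there plainly, is that the model's ONE operator datum per step must be the background-FAMILY
of the step's operators.  This part types that currency and shows the price is paid from POINTWISE data: `Fam 𝒰 E := ℓ^∞(𝒰; E)`
(Mathlib `lp (fun _ => E) ∞`, sup norm; the currency of record, R49 (3)), `famOf` (a raw family AS an ℓ^∞ family, junk `0` where
unbounded — the kernel meets it only on `B`-close pairs, `norm_famOf_sub_famOf_le`), `FamilySlots C 𝒰 Op Hist` = Bałaban's ONE step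
functional `Out k : Op → Hist → C.Dom × 𝒰 → ℂ` ([Balaban1988RG2Cluster] (2.13) p. 14, as in the kernel; allowed to read the chart
point — owner R49 (4), the complex chart's two real rows `(−I)^i · Out₀ k o h X`; plain case `Out₀ k o h X`) + the two runs' operator
FAMILIES `opA ∕ opB g k : Fam 𝒰 Op` + the two runs' function-table insertions `insA ∕ insB g k : (C.Dom × 𝒰 → ℝ) → Fam 𝒰 Hist` (the
(1.33) re-expression of the earlier terms READ AS FUNCTIONS of the background — R48-F's mathematical content, a PARAMETER here) +
base class + margins, and `FamilySlots.toStepModel : StepModel (paramCarriers C 𝒰) (Fam 𝒰 Op) (Fam 𝒰 Hist)` with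
`Out k 𝔬 𝔥 (X, u) := Out k (𝔬 u) (𝔥 u) (X, u)`.  Then ([folklore] bookkeeping, NO estimate):
* `representsB_iff` ∕ `representsA_iff`: the model represents the lifts iff, for every chart point `u`,
  `EB g (ρ u) X = Re Out k (opB g k u) (insB g k (uncurry (funTableB ρ EB g)) u) (X, u)` — Bałaban's recursion AT THE BACKGROUND `ρ u`
  with the operators AT `u` and the function-table insertion EVALUATED AT `u` (the print's shape, [II] (1.33) + (2.13)); `inBase_iff`.
* W1 `operatorRate_iff_pointwise`: the family rate IS the pointwise rate uniform in `u` (`lp.norm_le_of_forall_le'` ∕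
  `lp.norm_apply_le_norm`) — row NE2's per-background currency, read for all backgrounds of the chart.
* W2 `outputEnvelope_of_pointwise`: the kernel's `OutputEnvelope` for the family model follows from the POINTWISE envelope of `Out k`
  (complex-differentiable and `≤ G e^{−κd}` on the two-margin box around `(p.1 u, p.2 u)`, for every base point `p` and chart point `u`)
  by composition with the evaluation CLM `lp.evalCLM` — the sup-norm box maps into every pointwise box.
* W3 ∕ MI-3a `insScaleBoundLevel_of_pointwise`, `insertionDamped_of_pointwise`, `sizeDampedNat_of_pointwise`; structure
  `insAffine_of_pointwise`; W4-type `insertionRate_of_pointwise` — each family binder from its pointwise-in-`u` form (sup of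
  pointwise bounds), the table hypotheses being R48-F's sup-over-the-background entry bounds (part 1 `…_param_iff`).
* END `ne5_of_familySlots`: pointwise W2 + pointwise W1 + pointwise insertion binders + the two runs' decay bounds OVER `C` +
  representation of the lifts ⟹ `T4OutputRate.NE5 EA EB W κ θ C₅` over the ORIGINAL carriers (part 1's `ne5_of_stepModel_lift`).
* Part 3 (`OutputRateFunctionalTablesPointwise`) reads PER-BACKGROUND slots — the F-road's own data — through these families.
WHAT IS NOT HERE.  No instance on Bałaban's objects (the substrate's `slotsOfRecord` read family-wise is the instancer's); no
estimate of [II]; the function-table insertion `insB` is a PARAMETER (its construction from (1.33) is R48-F proper, either road).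
`ℓ^∞(𝒰; ·)` rather than `𝒰 →ᵇ ·` (substrate-typer (η2)(b), l.15841): the kernel needs no topology on the chart; a bounded continuous
family is in particular an `ℓ^∞` family (`memℓp_infty` of its bound).  0 sorry; axioms ⊆ {propext, Classical.choice, Quot.sound}.
-/

noncomputable section

open scoped BigOperators ENNReal
open Finset Function Metric Set

namespace Summit.QuantumFields.BalabanUV.T4Continuum.OutputRateFunctionalTablesFamily

open Literature.MathematicalPhysics.QuantumFieldTheory.Balaban1983to89
open Literature.MathematicalPhysics.QuantumFieldTheory.Balaban1983to89.T4OutputRate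
open Literature.MathematicalPhysics.QuantumFieldTheory.Balaban1983to89.T4InputCauchyRateData
open Summit.QuantumFields.BalabanUV.T4Continuum.OutputRateFunctionalTables

/-! ## §1 Background families with the sup norm -/

/-- [folklore] DATA: BACKGROUND FAMILIES of elements of `E` over the chart `𝒰` with the SUP NORM — Mathlib's `ℓ^∞(𝒰; E)`. -/
abbrev Fam (𝒰 : Type) (E : Type*) [NormedAddCommGroup E] : Type _ := ↥(lp (fun _ : 𝒰 => E) ∞)

variable {C : Carriers} {𝒰 : Type} {Op Hist : Type*} [NormedAddCommGroup Op] [NormedSpace ℂ Op] [NormedAddCommGroup Hist]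
  [NormedSpace ℂ Hist]

/-- [folklore] A coordinate of a family is bounded by the family's sup norm. -/
theorem norm_apply_le {E : Type*} [NormedAddCommGroup E] (f : Fam 𝒰 E) (u : 𝒰) : ‖f u‖ ≤ ‖f‖ :=
  lp.norm_apply_le_norm ENNReal.top_ne_zero f u

/-- [folklore] Coordinates of a difference are within the sup distance. -/
theorem norm_sub_apply_le {E : Type*} [NormedAddCommGroup E] (f g : Fam 𝒰 E) (u : 𝒰) : ‖f u - g u‖ ≤ ‖f - g‖ := by
  rw [← Pi.sub_apply, ← lp.coeFn_sub]
  exact norm_apply_le _ u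

/-- [folklore] A family's sup norm is at most any uniform bound of its coordinates (nonempty chart). -/
theorem norm_le_of_forall {E : Type*} [NormedAddCommGroup E] [Nonempty 𝒰] {f : Fam 𝒰 E} {B : ℝ} (h : ∀ u, ‖f u‖ ≤ B) :
    ‖f‖ ≤ B :=
  lp.norm_le_of_forall_le' B h

/-- [folklore] The sup distance of two families is at most any uniform bound of the coordinate distances. -/
theorem norm_sub_le_of_forall {E : Type*} [NormedAddCommGroup E] [Nonempty 𝒰] {f g : Fam 𝒰 E} {B : ℝ}
    (h : ∀ u, ‖f u - g u‖ ≤ B) : ‖f - g‖ ≤ B :=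
  norm_le_of_forall fun u => by simpa only [lp.coeFn_sub, Pi.sub_apply] using h u

open Classical in
/-- [folklore] DATA: a raw background family AS an `ℓ^∞` family — itself when bounded over the chart, the junk value `0` otherwise
(total by a classical case split; the kernel's binders only ever meet bounded families, `norm_famOf_sub_famOf_le`). -/
def famOf {E : Type*} [NormedAddCommGroup E] (f : 𝒰 → E) : Fam 𝒰 E :=
  if h : BddAbove (Set.range fun u => ‖f u‖) then ⟨f, memℓp_infty h⟩ else 0

/-- [folklore] A bounded raw family is read verbatim (as a family). -/
theorem famOf_eq {E : Type*} [NormedAddCommGroup E] {f : 𝒰 → E} (h : BddAbove (Set.range fun u => ‖f u‖)) :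
    famOf f = ⟨f, memℓp_infty h⟩ := by
  rw [famOf, dif_pos h]

/-- [folklore] A bounded raw family is read verbatim (coordinatewise). -/
theorem famOf_apply {E : Type*} [NormedAddCommGroup E] {f : 𝒰 → E} (h : BddAbove (Set.range fun u => ‖f u‖)) (u : 𝒰) :
    famOf f u = f u := by
  rw [famOf_eq h]

/-- [folklore] An unbounded raw family is read as the junk value `0`. -/
theorem famOf_eq_zero {E : Type*} [NormedAddCommGroup E] {f : 𝒰 → E} (h : ¬ BddAbove (Set.range fun u => ‖f u‖)) :
    famOf f = 0 := by
  rw [famOf, dif_neg h]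

/-- [folklore] A raw family uniformly near a bounded one is bounded. -/
theorem bddAbove_of_near {E : Type*} [NormedAddCommGroup E] {f g : 𝒰 → E} {B : ℝ}
    (hf : BddAbove (Set.range fun u => ‖f u‖)) (h : ∀ u, ‖f u - g u‖ ≤ B) : BddAbove (Set.range fun u => ‖g u‖) := by
  obtain ⟨M, hM⟩ := hf
  refine ⟨M + B, ?_⟩
  rintro _ ⟨u, rfl⟩
  have h1 : ‖f u‖ ≤ M := hM ⟨u, rfl⟩
  have h2 : ‖g u‖ ≤ ‖f u‖ + ‖f u - g u‖ := by
    calc ‖g u‖ = ‖f u - (f u - g u)‖ := by rw [sub_sub_cancel]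
      _ ≤ ‖f u‖ + ‖f u - g u‖ := norm_sub_le _ _
  linarith [h u]

/-- [folklore] **THE ONLY WAY THE KERNEL MEETS `famOf`**: two raw families within `B` of each other at every chart point are within
`B` in `ℓ^∞` after `famOf` (both bounded — verbatim; both unbounded — both junk; a mixed pair cannot be `B`-close). -/
theorem norm_famOf_sub_famOf_le {E : Type*} [NormedAddCommGroup E] [Nonempty 𝒰] {f g : 𝒰 → E} {B : ℝ}
    (h : ∀ u, ‖f u - g u‖ ≤ B) : ‖famOf f - famOf g‖ ≤ B := by
  have hB : 0 ≤ B := (norm_nonneg _).trans (h (Classical.arbitrary 𝒰))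
  by_cases hf : BddAbove (Set.range fun u => ‖f u‖)
  · have hg : BddAbove (Set.range fun u => ‖g u‖) := bddAbove_of_near hf h
    exact norm_sub_le_of_forall fun u => by rw [famOf_apply hf, famOf_apply hg]; exact h u
  · have hg : ¬ BddAbove (Set.range fun u => ‖g u‖) := fun hg =>
      hf (bddAbove_of_near hg fun u => by rw [norm_sub_rev]; exact h u)
    rw [famOf_eq_zero hf, famOf_eq_zero hg, sub_self, norm_zero]
    exact hB

/-- [folklore] DATA: a function table on the re-indexed domains READ AS a background-indexed family of tables on `C` (the
currency of row NE9's history families `Bg → C.Dom → ℝ` when `𝒰 = Bg`; leaf-06 F3, `CLAIMS.log` l.15813). -/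
def toBgFamily (t : C.Dom × 𝒰 → ℝ) : 𝒰 → C.Dom → ℝ := fun u X => t (X, u)

/-- [folklore] Run B's function table read as a background-indexed family: at the chart point `u` it is run B's VALUE table at `ρ u`. -/
theorem toBgFamily_funTableB (ρ : 𝒰 → C.BgB) (EB : Functional C C.BgB) (g : ℕ → ℝ) (u : 𝒰) :
    toBgFamily (uncurry (funTableB ρ EB g)) u = tableB EB g (ρ u) := rfl

/-! ## §2 Family slots and the step model over the re-indexed carriers -/

/-- [folklore] HYPOTHESIS-CARRYING DATA (no inequality inside): Bałaban's ONE pointwise step functional `Out k o h X` (as in the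
kernel), the two runs' operator data as BACKGROUND FAMILIES over the chart, the two runs' insertions of FUNCTION tables
`C.Dom × 𝒰 → ℝ` as background families of history data, the one-run admissible class of families, and the margins. -/
structure FamilySlots (C : Carriers) (𝒰 : Type) (Op Hist : Type*) [NormedAddCommGroup Op] [NormedSpace ℂ Op]
    [NormedAddCommGroup Hist] [NormedSpace ℂ Hist] where
  /-- the pointwise one-step output functional at step `k`, at a re-indexed domain `(X, u)` (it may read the chart point `u` —
  owner R49 (4): e.g. `(−I)^i · Out k o h X` on the complex chart's two real rows; for the plain case `Out k o h (X, u) := Out₀ k o h X`) -/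
  Out : ℕ → Op → Hist → C.Dom × 𝒰 → ℂ
  /-- run A's operator family at step `k` (coordinate `u` = the operators at the transported background `C.transport (ρ u)`) -/
  opA : (ℕ → ℝ) → ℕ → Fam 𝒰 Op
  /-- run B's operator family at step `k` (coordinate `u` = the operators at `ρ u`) -/
  opB : (ℕ → ℝ) → ℕ → Fam 𝒰 Op
  /-- run A's insertion of a function table, as a family of inserted histories -/
  insA : (ℕ → ℝ) → ℕ → (C.Dom × 𝒰 → ℝ) → Fam 𝒰 Hist
  /-- run B's insertion of a function table -/
  insB : (ℕ → ℝ) → ℕ → (C.Dom × 𝒰 → ℝ) → Fam 𝒰 Hist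
  /-- the one-run admissible class of (operator family, history family) at step `k` -/
  Base : ℕ → (ℕ → ℝ) → Set (Fam 𝒰 Op × Fam 𝒰 Hist)
  /-- operator margin -/
  rOp : ℕ → ℝ
  /-- history margin -/
  rHist : ℕ → ℝ
  rOp_pos : ∀ k, 0 < rOp k
  rHist_pos : ∀ k, 0 < rHist k

namespace FamilySlots

variable (S : FamilySlots C 𝒰 Op Hist)

/-- [folklore] THE STEP MODEL OVER THE RE-INDEXED CARRIERS assembled from family slots: the output at the re-indexed domain
`(X, u)` is the pointwise functional at the families' coordinates `u`; the trivial background slot is not read. -/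
def toStepModel : StepModel (paramCarriers C 𝒰) (Fam 𝒰 Op) (Fam 𝒰 Hist) where
  Out k 𝔬 𝔥 p := S.Out k (𝔬 p.2) (𝔥 p.2) p
  opA g _ k := S.opA g k
  opB g _ k := S.opB g k
  insA g _ k t := S.insA g k t
  insB g _ k t := S.insB g k t
  Base k g _ := S.Base k g
  rOp := S.rOp
  rHist := S.rHist
  rOp_pos := S.rOp_pos
  rHist_pos := S.rHist_pos

/-- [folklore] **`RepresentsB`, DISPLAYED** — Bałaban's recursion AT THE BACKGROUND `ρ u`: run B's term at `(X, ρ u)` is the real part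
of the pointwise functional at the operator family's coordinate `u` and at the coordinate `u` of the insertion of run B's FUNCTION
TABLE `(Y, u′) ↦ EB g (ρ u′) Y` ([II] (1.33): the earlier terms enter as functions of the background; (2.13)). -/
theorem representsB_iff (ρ : 𝒰 → C.BgB) (EB : Functional C C.BgB) (W : Set (ℕ → ℝ)) :
    S.toStepModel.RepresentsB (liftB ρ EB) W ↔ ∀ g ∈ W, ∀ (X : C.Dom) (u : 𝒰),
      EB g (ρ u) X =
        (S.Out (C.scale X) (S.opB g (C.scale X) u) (S.insB g (C.scale X) (uncurry (funTableB ρ EB g)) u) (X, u)).re :=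
  ⟨fun h g hg X u => h g hg PUnit.unit (X, u), fun h g hg _ p => h g hg p.1 p.2⟩

/-- [folklore] The same display for run A (transported chart backgrounds, run A's operator family and insertion). -/
theorem representsA_iff (ρ : 𝒰 → C.BgB) (EA : Functional C C.BgA) (W : Set (ℕ → ℝ)) :
    S.toStepModel.RepresentsA (liftA ρ EA) W ↔ ∀ g ∈ W, ∀ (X : C.Dom) (u : 𝒰),
      EA g (C.transport (ρ u)) X =
        (S.Out (C.scale X) (S.opA g (C.scale X) u) (S.insA g (C.scale X) (uncurry (funTableA ρ EA g)) u) (X, u)).re :=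
  ⟨fun h g hg X u => h g hg PUnit.unit (X, u), fun h g hg _ p => h g hg p.1 p.2⟩

/-- [folklore] `InBase`, displayed: run B's family data (operator family, inserted function table) lie in the one-run class. -/
theorem inBase_iff (ρ : 𝒰 → C.BgB) (EB : Functional C C.BgB) (W : Set (ℕ → ℝ)) :
    S.toStepModel.InBase (liftB ρ EB) W ↔
      ∀ k, ∀ g ∈ W, (S.opB g k, S.insB g k (uncurry (funTableB ρ EB g))) ∈ S.Base k g :=
  ⟨fun h k g hg => h k g hg PUnit.unit, fun h k g hg _ => h k g hg⟩

/-! ## §3 The kernel's binders for the family model from their POINTWISE-IN-THE-BACKGROUND forms -/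

/-- [folklore] **W1 — THE FAMILY OPERATOR RATE IS THE POINTWISE RATE UNIFORM IN THE BACKGROUND** (nonempty chart). -/
theorem operatorRate_iff_pointwise [Nonempty 𝒰] (W : Set (ℕ → ℝ)) (δ θ : ℝ) :
    S.toStepModel.OperatorRate W δ θ ↔
      ∀ k, ∀ g ∈ W, ∀ u : 𝒰, ‖S.opA g k u - S.opB g k u‖ ≤ δ * θ ^ k * S.rOp k := by
  refine ⟨fun h k g hg u => (norm_sub_apply_le _ _ u).trans (h k g hg PUnit.unit), fun h k g hg _ => ?_⟩
  exact norm_sub_le_of_forall (h k g hg)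

/-- [folklore] **W2 — THE FAMILY OUTPUT ENVELOPE FROM THE POINTWISE ENVELOPE**: if, around every base point `p` and at every chart
point `u`, the pointwise functional `z ↦ Out k z.1 z.2 X` is complex-differentiable on the two-margin box around `(p.1 u, p.2 u)` and
bounded there by `G·e^{−κ d(X)}`, then the family model satisfies the kernel's `OutputEnvelope` (the sup-norm box maps into every
pointwise box; composition with the evaluation CLM). -/
theorem outputEnvelope_of_pointwise {W : Set (ℕ → ℝ)} {κ G : ℝ}
    (h : ∀ k, ∀ g ∈ W, ∀ p ∈ S.Base k g, ∀ (X : C.Dom) (u : 𝒰), C.scale X = k →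
      DifferentiableOn ℂ (fun z : Op × Hist => S.Out k z.1 z.2 (X, u))
          (closedBall (p.1 u) (S.rOp k) ×ˢ closedBall (p.2 u) (S.rHist k)) ∧
        ∀ z ∈ closedBall (p.1 u) (S.rOp k) ×ˢ closedBall (p.2 u) (S.rHist k),
          ‖S.Out k z.1 z.2 (X, u)‖ ≤ G * Real.exp (-(κ * C.d X))) :
    S.toStepModel.OutputEnvelope W κ G := by
  intro k g hg _ p hp q hq
  obtain ⟨hdiff, hbd⟩ := h k g hg p hp q.1 q.2 hq
  have hmaps : MapsTo (fun z : Fam 𝒰 Op × Fam 𝒰 Hist => (z.1 q.2, z.2 q.2)) (S.toStepModel.box k p)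
      (closedBall (p.1 q.2) (S.rOp k) ×ˢ closedBall (p.2 q.2) (S.rHist k)) := by
    intro z hz
    simp only [StepModel.box, mem_prod, mem_closedBall, dist_eq_norm] at hz ⊢
    exact ⟨(norm_sub_apply_le _ _ _).trans hz.1, (norm_sub_apply_le _ _ _).trans hz.2⟩
  have hev : Differentiable ℂ (fun z : Fam 𝒰 Op × Fam 𝒰 Hist => (z.1 q.2, z.2 q.2)) :=
    ((lp.evalCLM ℂ (fun _ : 𝒰 => Op) ∞ q.2).differentiable.comp differentiable_fst).prodMk
      ((lp.evalCLM ℂ (fun _ : 𝒰 => Hist) ∞ q.2).differentiable.comp differentiable_snd)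
  refine ⟨?_, fun z hz => hbd _ (hmaps hz)⟩
  have heq : (fun z : Fam 𝒰 Op × Fam 𝒰 Hist => S.toStepModel.Out k z.1 z.2 q) =
      (fun z : Op × Hist => S.Out k z.1 z.2 (q.1, q.2)) ∘ fun z : Fam 𝒰 Op × Fam 𝒰 Hist => (z.1 q.2, z.2 q.2) := rfl
  rw [heq]
  exact hdiff.comp hev.differentiableOn hmaps

/-- [folklore] **W3 — THE SINGLE-SCALE SIZE BOUND OF THE FAMILY MODEL FROM ITS POINTWISE FORM** (nonempty chart): function tables
supported on one scale `j < k` with SUP-OVER-THE-BACKGROUND entries `≤ T·e^{−κd}` displace every coordinate of the inserted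
history family by `≤ c·ω^{k−1−j}·T` margins ⟹ the kernel's `InsScaleBoundLevel`. -/
theorem insScaleBoundLevel_of_pointwise [Nonempty 𝒰] {W : Set (ℕ → ℝ)} {κ c ω : ℝ}
    (h : ∀ k, ∀ g ∈ W, ∀ (t : C.Dom × 𝒰 → ℝ) (j : ℕ) (T : ℝ), j < k → 0 ≤ T →
      (∀ Y u, C.scale Y ≠ j → t (Y, u) = 0) → (∀ Y, C.scale Y = j → ∀ u, |t (Y, u)| ≤ T * Real.exp (-(κ * C.d Y))) →
        ∀ u, ‖S.insA g k t u - S.insA g k 0 u‖ ≤ S.rHist k * (c * (ω ^ (k - 1 - j) * T))) :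
    S.toStepModel.InsScaleBoundLevel W κ c ω := by
  rw [insScaleBoundLevel_param_iff]
  intro k g hg t j T hj hT hs hb
  exact norm_sub_le_of_forall (h k g hg t j T hj hT hs hb)

/-- [folklore] **MI-3a — THE DAMPED-LIPSCHITZ BINDER OF THE FAMILY MODEL FROM ITS POINTWISE FORM** (nonempty chart). -/
theorem insertionDamped_of_pointwise [Nonempty 𝒰] {W : Set (ℕ → ℝ)} {κ c ω : ℝ}
    (h : ∀ k, ∀ g ∈ W, ∀ (t t' : C.Dom × 𝒰 → ℝ) (D : ℕ → ℝ), (∀ j < k, 0 ≤ D j) →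
      (∀ Y, C.scale Y < k → ∀ u, |t (Y, u) - t' (Y, u)| ≤ D (C.scale Y) * Real.exp (-(κ * C.d Y))) →
        ∀ u, ‖S.insA g k t u - S.insA g k t' u‖ ≤ S.rHist k * (c * ∑ j ∈ range k, ω ^ (k - j) * D j)) :
    S.toStepModel.InsertionDamped W κ c ω := by
  rw [insertionDamped_param_iff]
  intro k g hg t t' D hD hb
  exact norm_sub_le_of_forall (h k g hg t t' D hD hb)

/-- [folklore] The summed size bound in the PRINTED age normalisation, from its pointwise form (nonempty chart). -/
theorem sizeDampedNat_of_pointwise [Nonempty 𝒰] {W : Set (ℕ → ℝ)} {κ c ω : ℝ}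
    (h : ∀ k, ∀ g ∈ W, ∀ (t : C.Dom × 𝒰 → ℝ) (T : ℕ → ℝ), (∀ j < k, 0 ≤ T j) →
      (∀ Y, C.scale Y < k → ∀ u, |t (Y, u)| ≤ T (C.scale Y) * Real.exp (-(κ * C.d Y))) →
        ∀ u, ‖S.insA g k t u - S.insA g k 0 u‖ ≤ S.rHist k * (c * ∑ j ∈ range k, ω ^ (k - 1 - j) * T j)) :
    S.toStepModel.SizeDampedNat W κ c ω := by
  intro k g hg _ t T hT hb
  exact norm_sub_le_of_forall (h k g hg t T hT fun Y hY u => hb (Y, u) hY)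

/-- [folklore] **`InsAffine` OF THE FAMILY MODEL FROM COORDINATEWISE AFFINITY** of the function-table insertion. -/
theorem insAffine_of_pointwise {W : Set (ℕ → ℝ)}
    (h : ∀ k, ∀ g ∈ W, ∀ (t t' : C.Dom × 𝒰 → ℝ) (u : 𝒰),
      S.insA g k t u - S.insA g k t' u = S.insA g k (t - t') u - S.insA g k 0 u) :
    S.toStepModel.InsAffine W := by
  intro k g hg _ t t'
  refine lp.ext (funext fun u => ?_)
  show (⇑(S.insA g k t - S.insA g k t')) u = (⇑(S.insA g k (t - t') - S.insA g k 0)) u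
  simpa only [lp.coeFn_sub, Pi.sub_apply] using h k g hg t t' u

/-- [folklore] The two runs' insertion rate of the family model from its pointwise form (nonempty chart): on function tables with
sup-over-the-background entries `≤ E₀·e^{−κd}`, every coordinate of the two inserted families differs by `≤ δ′θ^k` margins. -/
theorem insertionRate_of_pointwise [Nonempty 𝒰] {W : Set (ℕ → ℝ)} {κ E₀ δ' θ : ℝ}
    (h : ∀ k, ∀ g ∈ W, ∀ (t : C.Dom × 𝒰 → ℝ), (∀ Y u, |t (Y, u)| ≤ E₀ * Real.exp (-(κ * C.d Y))) →
      ∀ u, ‖S.insA g k t u - S.insB g k t u‖ ≤ δ' * θ ^ k * S.rHist k) :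
    S.toStepModel.InsertionRate W κ E₀ δ' θ := by
  intro k g hg _ t ht
  exact norm_sub_le_of_forall (h k g hg t fun Y u => ht (Y, u))

/-! ## §4 END: NE5 over the ORIGINAL carriers from family slots with pointwise binders -/

/-- [folklore] **NE5 OVER `C` FROM FAMILY SLOTS WITH POINTWISE-IN-THE-BACKGROUND BINDERS** (nonempty chart onto the run-B
backgrounds): representation of the two runs' lifts (function tables READ), run B's family data admissible, the POINTWISE output
envelope, the two runs' decay bounds over `C`, the POINTWISE operator rate (row NE2's currency for every background), the
POINTWISE insertion rate and damped-Lipschitz binder, and the kernel's smallness ⟹ `T4OutputRate.NE5 EA EB W κ θ C₅` with the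
kernel's constant — part 1's `ne5_of_stepModel_lift` on `S.toStepModel`.  Nothing of the kernel re-proved. -/
theorem ne5_of_familySlots [Nonempty 𝒰] {ρ : 𝒰 → C.BgB} (hρ : Surjective ρ) {EA : Functional C C.BgA}
    {EB : Functional C C.BgB} {W : Set (ℕ → ℝ)} {κ G E₀ δ δ' θ c ω : ℝ}
    (hrA : S.toStepModel.RepresentsA (liftA ρ EA) W) (hrB : S.toStepModel.RepresentsB (liftB ρ EB) W)
    (hbase : S.toStepModel.InBase (liftB ρ EB) W)
    (henv : ∀ k, ∀ g ∈ W, ∀ p ∈ S.Base k g, ∀ (X : C.Dom) (u : 𝒰), C.scale X = k →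
      DifferentiableOn ℂ (fun z : Op × Hist => S.Out k z.1 z.2 (X, u))
          (closedBall (p.1 u) (S.rOp k) ×ˢ closedBall (p.2 u) (S.rHist k)) ∧
        ∀ z ∈ closedBall (p.1 u) (S.rOp k) ×ˢ closedBall (p.2 u) (S.rHist k),
          ‖S.Out k z.1 z.2 (X, u)‖ ≤ G * Real.exp (-(κ * C.d X)))
    (hdA : DecayBound EA W G κ) (hdB : DecayBound EB W E₀ κ) (hE₀ : E₀ ≤ G)
    (hop : ∀ k, ∀ g ∈ W, ∀ u : 𝒰, ‖S.opA g k u - S.opB g k u‖ ≤ δ * θ ^ k * S.rOp k)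
    (hins : ∀ k, ∀ g ∈ W, ∀ (t : C.Dom × 𝒰 → ℝ), (∀ Y u, |t (Y, u)| ≤ E₀ * Real.exp (-(κ * C.d Y))) →
      ∀ u, ‖S.insA g k t u - S.insB g k t u‖ ≤ δ' * θ ^ k * S.rHist k)
    (hdamp : ∀ k, ∀ g ∈ W, ∀ (t t' : C.Dom × 𝒰 → ℝ) (D : ℕ → ℝ), (∀ j < k, 0 ≤ D j) →
      (∀ Y, C.scale Y < k → ∀ u, |t (Y, u) - t' (Y, u)| ≤ D (C.scale Y) * Real.exp (-(κ * C.d Y))) →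
        ∀ u, ‖S.insA g k t u - S.insA g k t' u‖ ≤ S.rHist k * (c * ∑ j ∈ range k, ω ^ (k - j) * D j))
    (hG : 0 ≤ G) (hδ : 0 ≤ δ + δ') (hc : 0 ≤ c) (hω : 0 ≤ ω) (hsmall : (1 + 4 * G * c) * ω < θ) :
    NE5 EA EB W κ θ (4 * G * (δ + δ') * (θ - ω) / (θ - (1 + 4 * G * c) * ω)) :=
  ne5_of_stepModel_lift S.toStepModel hρ hrA hrB hbase (S.outputEnvelope_of_pointwise henv) hdA hdB hE₀
    ((S.operatorRate_iff_pointwise W δ θ).2 hop) (S.insertionRate_of_pointwise hins) (S.insertionDamped_of_pointwise hdamp)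
    hG hδ hc hω hsmall

end FamilySlots

end Summit.QuantumFields.BalabanUV.T4Continuum.OutputRateFunctionalTablesFamily

end
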